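import Summits.CriticalPhenomena.PercolationContinuityZ3.Theorems.Transplant.SkelFrmFromBParamsFaceA
import Summits.CriticalPhenomena.PercolationContinuityZ3.Theorems.Transplant.SkelFrmBParamsFaceA
import Summits.CriticalPhenomena.PercolationContinuityZ3.Theorems.Transplant.SkelNegBParamsFaceA
import Summits.CriticalPhenomena.PercolationContinuityZ3.Theorems.Transplant.SkelPhiFaceSlots2
import Summits.CriticalPhenomena.PercolationContinuityZ3.Theorems.Transplant.SkelFrmFromBParamsSlots
import Summits.CriticalPhenomena.PercolationContinuityZ3.Theorems.Transplant.SkelFrmBParamsSlots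
import Summits.CriticalPhenomena.PercolationContinuityZ3.Theorems.Transplant.SkelNegBParamsSlots
import Summits.CriticalPhenomena.PercolationContinuityZ3.Theorems.Transplant.SkelFrmFrom1SlotTypes
import Summits.CriticalPhenomena.PercolationContinuityZ3.Theorems.Transplant.SkelFrm1SlotTypes
import Summits.CriticalPhenomena.PercolationContinuityZ3.Theorems.Transplant.SkelFrmFrom1ParamsPO
import Summits.CriticalPhenomena.PercolationContinuityZ3.Theorems.Transplant.SkelFrm1ParamsPO
import Summits.CriticalPhenomena.PercolationContinuityZ3.Theorems.Transplant.SkelFrmFrom1ParamsLBL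
import Summits.CriticalPhenomena.PercolationContinuityZ3.Theorems.Transplant.SkelFrm1ParamsLBL
import Summits.CriticalPhenomena.PercolationContinuityZ3.Theorems.Transplant.SkelFrmFromBParamsKitA
import Summits.CriticalPhenomena.PercolationContinuityZ3.Theorems.Transplant.SkelFrmBParamsKitA
import Summits.CriticalPhenomena.PercolationContinuityZ3.Theorems.Transplant.SkelFrmFromBParamsKitS
import Summits.CriticalPhenomena.PercolationContinuityZ3.Theorems.Transplant.SkelFrmBParamsKitS
import Summits.CriticalPhenomena.PercolationContinuityZ3.Theorems.Transplant.SkelFrmFrom1ParamsLF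
import Summits.CriticalPhenomena.PercolationContinuityZ3.Theorems.Transplant.SkelFrm1ParamsLF
import Summits.CriticalPhenomena.PercolationContinuityZ3.Theorems.Transplant.SkelFrmFrom1ParamsLO
import Summits.CriticalPhenomena.PercolationContinuityZ3.Theorems.Transplant.SkelFrm1ParamsLO
import Summits.CriticalPhenomena.PercolationContinuityZ3.Theorems.Transplant.SkelFrmFromBParamsLF
import Summits.CriticalPhenomena.PercolationContinuityZ3.Theorems.Transplant.SkelFrmBParamsLF
import Summits.CriticalPhenomena.PercolationContinuityZ3.Theorems.Transplant.SkelFrmFromBParamsFineSize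
import Summits.CriticalPhenomena.PercolationContinuityZ3.Theorems.Transplant.SkelFrmBParamsFineSize
import Summits.CriticalPhenomena.PercolationContinuityZ3.Theorems.Transplant.SkelFrmFromBParamsLFA
import Summits.CriticalPhenomena.PercolationContinuityZ3.Theorems.Transplant.SkelFrmBParamsLFA
import Summits.CriticalPhenomena.PercolationContinuityZ3.Theorems.Transplant.SkelFrmFromBParamsLO
import Summits.CriticalPhenomena.PercolationContinuityZ3.Theorems.Transplant.SkelFrmBParamsLO
import Summits.CriticalPhenomena.PercolationContinuityZ3.Theorems.Transplant.SkelFrmFromBParamsB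
import Summits.CriticalPhenomena.PercolationContinuityZ3.Theorems.Transplant.SkelFrmBParamsB
import Summits.CriticalPhenomena.PercolationContinuityZ3.Theorems.Transplant.SkelFrmFromBParamsFineSizeA
import Summits.CriticalPhenomena.PercolationContinuityZ3.Theorems.Transplant.SkelFrmBParamsFineSizeA
import Summits.CriticalPhenomena.PercolationContinuityZ3.Theorems.Transplant.SkelFrmFromBParamsSlotsR
import Summits.CriticalPhenomena.PercolationContinuityZ3.Theorems.Transplant.SkelFrmBParamsSlotsR
import Summits.CriticalPhenomena.PercolationContinuityZ3.Theorems.Transplant.SkelFrmFromBParamsSlotsRS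
import Summits.CriticalPhenomena.PercolationContinuityZ3.Theorems.Transplant.SkelFrmBParamsSlotsRS
import Summits.CriticalPhenomena.PercolationContinuityZ3.Theorems.Transplant.SkelFrmFromBParamsSched
import Summits.CriticalPhenomena.PercolationContinuityZ3.Theorems.Transplant.SkelFrmBParamsSched
import Summits.CriticalPhenomena.PercolationContinuityZ3.Theorems.Transplant.SkelFrmFromBParamsSlotsT
import Summits.CriticalPhenomena.PercolationContinuityZ3.Theorems.Transplant.SkelFrmBParamsSlotsT
import Summits.CriticalPhenomena.PercolationContinuityZ3.Theorems.Transplant.SkelFrmFromBParamsReachFC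
import Summits.CriticalPhenomena.PercolationContinuityZ3.Theorems.Transplant.SkelFrmBParamsReachFC
import Summits.CriticalPhenomena.PercolationContinuityZ3.Theorems.Transplant.SkelFrmFromBParamsSlotsTA
import Summits.CriticalPhenomena.PercolationContinuityZ3.Theorems.Transplant.SkelFrmBParamsSlotsTA
import Summits.CriticalPhenomena.PercolationContinuityZ3.Theorems.Transplant.SkelFrmFromBParamsFaceLat
import Summits.CriticalPhenomena.PercolationContinuityZ3.Theorems.Transplant.SkelFrmBParamsFaceLat
import Summits.CriticalPhenomena.PercolationContinuityZ3.Theorems.Transplant.SkelFrmFromBParamsFaceLatA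
import Summits.CriticalPhenomena.PercolationContinuityZ3.Theorems.Transplant.SkelFrmBParamsFaceLatA
import Summits.CriticalPhenomena.PercolationContinuityZ3.Theorems.Transplant.SkelFrmFromBParamsFace
import Summits.CriticalPhenomena.PercolationContinuityZ3.Theorems.Transplant.SkelFrmBParamsFace
import Summits.CriticalPhenomena.PercolationContinuityZ3.Theorems.Transplant.SkelNegBParamsFaceRoomsA
import Summits.CriticalPhenomena.PercolationContinuityZ3.Theorems.Transplant.PlanarSkeletonFrmFromDefs
import Summits.CriticalPhenomena.PercolationContinuityZ3.Theorems.Transplant.PlanarSkeletonFrmDefs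
import Summits.CriticalPhenomena.PercolationContinuityZ3.Theorems.Transplant.SkelPhiStepIDataNS
import HarnessLib
import Summits.CriticalPhenomena.PercolationContinuityZ3.Theorems.Transplant.SkelFrmBParamsFaceRoomsA
/-!
# U-WAVE PORT (RULING D-U, lead g21 2026-08-26; WAVE-U-MANIFEST v3.1 row «SkelFrmBParamsFaceRoomsA» ↦ «SkelFrmFromBParamsFaceRoomsA») of the tree module
# `Transplant/SkelFrmBParamsFaceRoomsA` onto the carrier `PlanarSkeletonFrmFrom` (frames only, cylinders connected from width `ℓ₀` on)

ORIGINAL TITLE: N2 (frames-only node `SamePDropOfSkeletonFrmFrom₁`, OPEN) params column over `PlanarSkeletonFrm` — (ζ″) ledger, shape (B′) of record ((R-14)):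

builds on p205010 (kernel theorem, internal audit signed; external expert review pending) — nothing in this file uses p205010; NOTHING is claimed about the
OPEN node U `SamePDropOfSkeletonFrmFrom₁` (nor U_s / the end state).  Lane `prim-bschramm`, seat `prim-bschramm-stmt` gen 26 (port pen, RULING M-11 family P-stmt; tool = p3-g26's port_u.py of record, registry-driven inputs); helper file
(`--supports stmt-CriticalPhenomena-4575 --as helper`).  PORT RULES r1–r4 of RULING D-U: declaration order and proof texts are those of the original,
byte-identical except (i) the carrier token `PlanarSkeletonFrm ↦ PlanarSkeletonFrmFrom` (binders, `namespace`/`end` lines, qualified names of twinned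
declarations), (ii) carrier-FREE declarations of the original (φ-level `Skelφ…` blocks and namespace-only arithmetic residents) are NOT re-declared —
this file imports the original and `export`s the twin-free residents (POLICY T / treatment (m1)); residents whose statement mentions a twinned
constant are copied, (iii) every carrier-binding declaration keeps its explicit binder `(Φ : PlanarSkeletonFrmFrom G)` in its own signature (r2).  Docstrings and citations are the original's.
-/

noncomputable section

open scoped Classical

namespace Summit.CriticalPhenomena.PercolationContinuityZ3.Theorems.Transplant

namespace PlanarSkeletonFrmFrom

namespace NegB

open Literature.Probability.Percolation Literature.Probability.LatticeModels SimpleGraph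
open Literature.Probability.Percolation.KozmaNitzan.Cells (oth)
open SkelConc (Consts)
open SkelI (tanOff)
open Skelφ (shellD)
open Skelφ.StepI (DataN)
open Neg

/-! ## §1 Levels vs cells, the count unit, the frame rooms (at `g := KS.gT mk gx`) -/

section Rooms

/-- `RlevA ≤ RA′` (`RA′ = RlevA + 1`) — the `hRl` of FaceA's `hkF_RA` at `Rl := RlevA`. [folklore] -/
theorem RlevA_le_RA' (κ : Consts) {V : Type} [Countable V] {G : SimpleGraph V} [G.LocallyFinite] (Φ : PlanarSkeletonFrmFrom G) (t : V) (p : unitInterval) (D : Skelφ.StepI.DataNS V) (mk : ℕ) : KS.RlevA κ Φ t p D mk ≤ KS.RA' κ Φ t p D mk := by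
  rw [← (KS.RA'_eq κ Φ t p D mk).2.1]; exact Nat.le_succ _

/-- **Levels vs the (ζ′) cells** at `g := gT`: `RlevA + 4 ≤ 10·s_i` and `RlevA + 4 ≤ 3·r_i` (hp-8's `hRlev/hRlev'`; `s_i ≥ 6RA′+11`, `RA′ = RlevA + 1`,
`r_i = K·s_i`, `K ≥ 40`). [folklore] -/
theorem hRlev_RA (κ : Consts) {V : Type} [DecidableEq V] [Countable V] {G : SimpleGraph V} [G.LocallyFinite] (Φ : PlanarSkeletonFrmFrom G) (t : V) (p : unitInterval) (D : Skelφ.StepI.DataNS V) (f : ℕ) (mk : ℕ) (gx : Neg.FSlot) (hN : EqNumL κ Φ t p D (KS.gT mk gx κ Φ t p D) f) (hκ : (hL κ Φ t p D (KS.gT mk gx κ Φ t p D) f).natAbs ≤ 10 * nL κ Φ t p D (KS.gT mk gx κ Φ t p D) f)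
    (i : Fin 2) :
    KS.RlevA κ Φ t p D mk + 4 ≤ 10 * (fcellsA κ Φ t p D (KS.gT mk gx κ Φ t p D) f).s i ∧ KS.RlevA κ Φ t p D mk + 4 ≤ 3 * (fcellsA κ Φ t p D (KS.gT mk gx κ Φ t p D) f).r i := by
  obtain ⟨h0, h1⟩ := KS.cells_geTA' κ Φ t p D mk gx f hN hκ
  have hR := (KS.RA'_eq κ Φ t p D mk).2.1
  have hr := (fcellsA_K κ Φ t p D (KS.gT mk gx κ Φ t p D) f).2.2 i
  have hK := (Neg.forty_le_K κ).1
  have hs : KS.RA' κ Φ t p D mk + 3 ≤ (fcellsA κ Φ t p D (KS.gT mk gx κ Φ t p D) f).s i := by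
    obtain rfl | rfl : i = 0 ∨ i = 1 := by fin_cases i <;> simp
    · have : ((KS.RA' κ Φ t p D mk : ℕ) : ℤ) + 3 ≤ (((fcellsA κ Φ t p D (KS.gT mk gx κ Φ t p D) f).s 0 : ℕ) : ℤ) := by linarith
      exact_mod_cast this
    · have : ((KS.RA' κ Φ t p D mk : ℕ) : ℤ) + 3 ≤ (((fcellsA κ Φ t p D (KS.gT mk gx κ Φ t p D) f).s 1 : ℕ) : ℤ) := by linarith
      exact_mod_cast this
  constructor
  · omega
  · rw [hr]; nlinarith

/-- **The face count unit** `nFc I := c_I·|A|·|lv_I(bOf I)|` at the (ζ′) record: nonnegative and `D_A ≤ 3·nFc I` (hp-8's `hnC/hU3`; from `11·D_A < 13·c_I·L_I ≤ 26·A·rdK_I`).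
[folklore] -/
theorem nFc_RA (κ : Consts) {V : Type} [DecidableEq V] [Countable V] {G : SimpleGraph V} [G.LocallyFinite] (Φ : PlanarSkeletonFrmFrom G) (t : V) (p : unitInterval) (D : Skelφ.StepI.DataNS V) (f : ℕ) (mk : ℕ) (gx : Neg.FSlot) (hN : EqNumL κ Φ t p D (KS.gT mk gx κ Φ t p D) f) (hκ : (hL κ Φ t p D (KS.gT mk gx κ Φ t p D) f).natAbs ≤ 10 * nL κ Φ t p D (KS.gT mk gx κ Φ t p D) f)
    (I : Fin 2) :
    0 ≤ (prFA κ Φ t p D (KS.gT mk gx κ Φ t p D) f).cOf I * |(prFA κ Φ t p D (KS.gT mk gx κ Φ t p D) f).A| *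
        |(prFA κ Φ t p D (KS.gT mk gx κ Φ t p D) f).lvGen I ((prFA κ Φ t p D (KS.gT mk gx κ Φ t p D) f).bOf I)| ∧
      (prFA κ Φ t p D (KS.gT mk gx κ Φ t p D) f).D ≤ 3 * ((prFA κ Φ t p D (KS.gT mk gx κ Φ t p D) f).cOf I * |(prFA κ Φ t p D (KS.gT mk gx κ Φ t p D) f).A| *
        |(prFA κ Φ t p D (KS.gT mk gx κ Φ t p D) f).lvGen I ((prFA κ Φ t p D (KS.gT mk gx κ Φ t p D) f).bOf I)|) := by
  set pr := prFA κ Φ t p D (KS.gT mk gx κ Φ t p D) f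
  have hs := eleven_le_s_TA κ Φ t p D f mk gx hN hκ I
  have h1 := cL_lowerA κ Φ t p D (KS.gT mk gx κ Φ t p D) f hN I hs
  have h2 := rdK_lowerA κ Φ t p D (KS.gT mk gx κ Φ t p D) f I
  have hA : pr.A = Aof κ := (prFA_fields κ Φ t p D (KS.gT mk gx κ Φ t p D) f).1
  have hA0 : 0 < Aof κ := (Aof_pos κ).1
  have hc : 0 ≤ pr.cOf I := (pr.cOf_pos (prFA_c_pos κ Φ t p D _ f).1 (prFA_c_pos κ Φ t p D _ f).2 I).le
  have e : pr.cOf I * |pr.A| * |pr.lvGen I (pr.bOf I)| = Aof κ * pr.rdK I (pr.bOf I) := by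
    unfold Skelφ.FinePrm.rdK; rw [hA, abs_of_pos hA0]; ring
  rw [e]
  have hK0 : 0 ≤ pr.rdK I (pr.bOf I) := by unfold Skelφ.FinePrm.rdK; exact mul_nonneg hc (abs_nonneg _)
  constructor
  · exact mul_nonneg hA0.le hK0
  · nlinarith

end Rooms

section Frame

/-- `0 < D_A` at the (ζ′) record under the numeric long clause. [folklore] -/
theorem prFA_D_pos (κ : Consts) {V : Type} [DecidableEq V] [Countable V] {G : SimpleGraph V} [G.LocallyFinite] (Φ : PlanarSkeletonFrmFrom G) (t : V) (p : unitInterval) (D : Skelφ.StepI.DataNS V) (g : ℕ) (f : ℕ) (hN : EqNumL κ Φ t p D g f) : 0 < (prFA κ Φ t p D g f).D := by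
  obtain ⟨hn1, hℓ1⟩ := one_le_of_eqNumL κ Φ t p D g f hN
  rw [(prFA_fields κ Φ t p D g f).2.2.2.2.2.2.2]; exact Skelφ.NegPrm.DofA_pos (Aof_pos κ).2 hn1 hℓ1 _ _

/-- `0 ≤ awF₂ (prFA) fcellsA du` (the ceiling of a nonnegative numerator by `Mabs > 0`). [folklore] -/
theorem awF₂_nonneg_A (κ : Consts) {V : Type} [DecidableEq V] [Countable V] {G : SimpleGraph V} [G.LocallyFinite] (Φ : PlanarSkeletonFrmFrom G) (t : V) (p : unitInterval) (D : Skelφ.StepI.DataNS V) (g : ℕ) (f : ℕ) (hN : EqNumL κ Φ t p D g f) (du : MDir) : 0 ≤ (prFA κ Φ t p D g f).awF₂ (fcellsA κ Φ t p D g f) du := by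
  set pr := prFA κ Φ t p D g f
  set P := fcellsA κ Φ t p D g f
  obtain ⟨hc₀, hc₁⟩ := prFA_c_pos κ Φ t p D g f
  have hDd := prFA_D κ Φ t p D g f
  have hDpos := prFA_D_pos κ Φ t p D g f hN
  have hM := pr.Mabs_pos hc₀ hc₁ hDd hDpos
  have hfe : ∀ i : Fin 2, 0 ≤ P.faceExt du i := fun i => by unfold PCells2.faceExt; split_ifs <;> positivity
  have hrd : ∀ I b, 0 ≤ pr.rdK I b := fun I b => by
    unfold Skelφ.FinePrm.rdK; exact mul_nonneg (pr.cOf_pos hc₀ hc₁ I).le (abs_nonneg _)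
  unfold Skelφ.FinePrm.awF₂ Skelφ.FinePrm.awNum
  apply Int.ediv_nonneg _ hM.le
  have h1 := hrd 1 (pr.bOf du.1); have h0 := hrd 0 (pr.bOf du.1); have e0 := hfe 0; have e1 := hfe 1
  have : 0 ≤ (pr.rdK 1 (pr.bOf du.1) * (P.faceExt du 0 + 1) + pr.rdK 0 (pr.bOf du.1) * (P.faceExt du 1 + 1)) * pr.D := by positivity
  linarith

/-- **`hroomF` at the (ζ′) record** with `aw du := (awF₂ du).toNat`, `kF := kFF₂ Rlev` (FaceSlots2 `hroomF_kFF₂`). [cite: KozmaNitzan2024, §4 Lemma 12 (pp. 23–25)] -/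
theorem hroomF_RA (κ : Consts) {V : Type} [DecidableEq V] [Countable V] {G : SimpleGraph V} [G.LocallyFinite] (Φ : PlanarSkeletonFrmFrom G) (t : V) (p : unitInterval) (D : Skelφ.StepI.DataNS V) (g : ℕ) (f : ℕ) (hN : EqNumL κ Φ t p D g f) (Rlev : ℕ) (du : MDir) :
    (prFA κ Φ t p D g f).Mabs * (((((prFA κ Φ t p D g f).awF₂ (fcellsA κ Φ t p D g f) du).toNat : ℕ) : ℤ) + (Rlev : ℤ) + 1) +
        (prFA κ Φ t p D g f).rdN du.1 ((prFA κ Φ t p D g f).bOf du.1) * ((Rlev : ℤ) + 2) * (prFA κ Φ t p D g f).D ≤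
      (prFA κ Φ t p D g f).rdK du.1 ((prFA κ Φ t p D g f).bOf du.1) * (prFA κ Φ t p D g f).kFF₂ (fcellsA κ Φ t p D g f) Rlev du.1 * (prFA κ Φ t p D g f).D := by
  obtain ⟨hc₀, hc₁⟩ := prFA_c_pos κ Φ t p D g f
  rw [Int.toNat_of_nonneg (awF₂_nonneg_A κ Φ t p D g f hN du)]
  exact (prFA κ Φ t p D g f).hroomF_kFF₂ hc₀ hc₁ (prFA_D κ Φ t p D g f) (prFA_D_pos κ Φ t p D g f hN) (fcellsA κ Φ t p D g f) Rlev du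

/-- **`haw` at the (ζ′) record** with `aw du := (awF₂ du).toNat` (FaceSlots2 `haw_awF₂`). [cite: KozmaNitzan2024, §4 Lemma 12 (pp. 23–25)] -/
theorem haw_RA (κ : Consts) {V : Type} [DecidableEq V] [Countable V] {G : SimpleGraph V} [G.LocallyFinite] (Φ : PlanarSkeletonFrmFrom G) (t : V) (p : unitInterval) (D : Skelφ.StepI.DataNS V) (g : ℕ) (f : ℕ) (hN : EqNumL κ Φ t p D g f) (du : MDir) :
    ((prFA κ Φ t p D g f).rdK 1 ((prFA κ Φ t p D g f).bOf du.1) * ((fcellsA κ Φ t p D g f).faceExt du 0 + 1) +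
          (prFA κ Φ t p D g f).rdK 0 ((prFA κ Φ t p D g f).bOf du.1) * ((fcellsA κ Φ t p D g f).faceExt du 1 + 1)) * (prFA κ Φ t p D g f).D ≤
      (prFA κ Φ t p D g f).Mabs * (((((prFA κ Φ t p D g f).awF₂ (fcellsA κ Φ t p D g f) du).toNat : ℕ) : ℤ) + 1) := by
  obtain ⟨hc₀, hc₁⟩ := prFA_c_pos κ Φ t p D g f
  rw [Int.toNat_of_nonneg (awF₂_nonneg_A κ Φ t p D g f hN du)]
  exact (prFA κ Φ t p D g f).haw_awF₂ hc₀ hc₁ (prFA_D κ Φ t p D g f) (prFA_D_pos κ Φ t p D g f hN) (fcellsA κ Φ t p D g f) du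

end Frame

/-! ## §2 The face kit's counts at `κ.δ₂` and the face apron's rooms (cell-free) -/

/-! §Kit of the N1 file (`counts_face_T`, `faceApron_rooms_T`) is NOT ported: N1's apron kit and its counts `KS.counts_R` are RETIRED under (S0)/(R-35);
the face kit's counts / rooms rows are served in N2 by stmt's `NegB.KS0` block (`counts_atq_face`, `hr₀_kit0`, `hreach_kit0`, `levels_wide`; SkelFrmBChoiceNums
p347587) — hp-8 g42's (B)(iii) 're-fitted, not renamed'. -/

end NegB

end PlanarSkeletonFrmFrom

end Summit.CriticalPhenomena.PercolationContinuityZ3.Theorems.Transplant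

end
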